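import Literature.Analysis.FluidPDE.FracNSPotentialEquation
import HarnessLib

/-!
# De Rosa's gluing stage, Prop. 5.4: the forcing bound (5.28) for the vector potential

L. De Rosa, *Infinitely many Leray–Hopf solutions for the fractional Navier–Stokes equations*,
Comm. PDE 44 (2019) 335–365 = arXiv:1801.10235, §5.2, proof of Prop. 5.4 (p. 13), (5.27)–(5.28):
"`∂ₜz̃ᵢ + (v_ℓ·∇)z̃ᵢ + ν(-Δ)^γ z̃ᵢ = -Δ⁻¹curl div((z̃ᵢ×∇)v) - Δ⁻¹∇div((z̃ᵢ·∇)v_ℓ) - Δ⁻¹curl div R̊_ℓ`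
… using `-Δ⁻¹ curl div` and `Δ⁻¹∇div` are bounded operators of order zero on Hölder spaces,
`‖(∂ₜ + v_ℓ·∇ + ν(-Δ)^γ)z̃ᵢ‖_{N+α} ≲ ‖v‖_{1+α}‖z̃ᵢ‖_{N+α} + ‖v‖_{N+1+α}‖z̃ᵢ‖_α + ‖R̊_ℓ‖_{N+α}`"
(`v` standing for `v_ℓ`, `vᵢ`).

For the right-hand side of `DeRosa.fracPotential_transport_eq`
(`-ℬ((w·∇)vᵢ) - ℬ(div R̊_ℓ) + ℬ(C₁) + ∇Δ⁻¹div((z̃·∇)v_ℓ)`) this file proves that bound from the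
Calderón–Zygmund estimate `BDSV.holderCZBound` (proved: `BDSV.holderCZBound_holds`):

* `eContDiffHolderNorm_le_sum_coord` — a vector field is dominated by its coordinates;
* `BDSV.holderCZBound.biotSavart_divStructure_le` — **`ℬ ∘ div` is of order zero**:
  `‖ℬF‖_{N,α} ≤ C ∑_c ‖Q_c‖_{N,α}` when `F_c = div Q_c`;
* `BDSV.holderCZBound.gradient_invLaplacian_divergence_le` — **`∇Δ⁻¹div` is of order zero**;
* the divergence structures: `(w·∇)vᵢ` with `w = curl z̃` (`BDSV.sum_curl_mul_partialDeriv_eq_divergence`),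
  `div R̊_ℓ`, and `C₁` (`BDSV.curl_convect`, `BDSV.convect_partialDeriv_apply_eq_divergence`);
* `BDSV.holderCZBound.fracPotential_rhs_le` — **(5.28)**: for `0 < α < 1` and `N` there is `C` with
  `‖RHS‖_{N,α} ≤ C (∑_{j ≤ N} ‖z̃‖_{j,α}(‖vᵢ‖_{N-j+1,α} + ‖v_ℓ‖_{N-j+1,α}) + ‖R̊_ℓ‖_{N,α})`.

## References

* L. De Rosa, Comm. PDE 44 (2019) = arXiv:1801.10235, §5.2 proof of Prop. 5.4, (5.27)–(5.28).
  [`Derosa2018`]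
* T. Buckmaster, C. De Lellis, L. Székelyhidi Jr., V. Vicol, CPAM 72 (2019) = arXiv:1701.08678,
  §3.3 proof of Prop. 3.4, App. C Prop. C.1. [`BuckmasterEtAl2018`]
-/

noncomputable section

open MeasureTheory Set Filter Function
open scoped NNReal ENNReal ContDiff

namespace Literature.Analysis.FluidPDE

/-! ## Order-zero operators on `C^{N,α}(𝕋³)` -/


namespace BDSV

open FunctionSpaces FunctionSpaces.Torus

/-- The coordinates of `Δ⁻¹F`: `(Δ⁻¹F)_c = Δ⁻¹(F_c)`. [folklore] -/
theorem invLaplacian_apply_coord {F : UnitAddTorus (Fin 3) → EuclideanSpace ℝ (Fin 3)} (hF : IsSmooth F) (c : Fin 3) :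
    (fun y => FunctionSpaces.Torus.invLaplacian F y c) = FunctionSpaces.Torus.invLaplacian (fun y => F y c) := by
  have h := invLaplacian_clm_comp hF (EuclideanSpace.proj c : EuclideanSpace ℝ (Fin 3) →L[ℝ] ℝ)
  have h2 : ((EuclideanSpace.proj c : EuclideanSpace ℝ (Fin 3) →L[ℝ] ℝ) : EuclideanSpace ℝ (Fin 3) → ℝ) ∘ F = fun y => F y c := rfl
  rw [h2] at h
  funext y
  rw [h]
  rfl

/-- **`ℬ ∘ div` is an operator of order zero on `C^{N,α}(𝕋³)`** (De Rosa: "`-Δ⁻¹ curl div` … bounded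
operator of order zero on Hölder spaces"): from `BDSV.holderCZBound`, for `0 < α < 1` and `N` there
is `C` such that for smooth `F, Q₀, Q₁, Q₂` with `F_c = div Q_c`:
`‖ℬF‖_{N,α} ≤ C ∑_c ‖Q_c‖_{N,α}` (`(ℬF)_a = -(curl Δ⁻¹F)_a`, `∂_bΔ⁻¹div Q_c = ∑_k ∂_b∂_kΔ⁻¹ Q_c^k`).
[cite: Derosa2018, §5.2 proof of Prop. 5.4 ((5.28))] -/
theorem holderCZBound.biotSavart_divStructure_le (hCZ : holderCZBound) {α : ℝ≥0} (hα : 0 < α) (hα1 : α < 1)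
    (N : ℕ) :
    ∃ C : ℝ≥0, ∀ (F : UnitAddTorus (Fin 3) → EuclideanSpace ℝ (Fin 3))
      (Q : Fin 3 → UnitAddTorus (Fin 3) → EuclideanSpace ℝ (Fin 3)), IsSmooth F → (∀ c, IsSmooth (Q c)) →
      (∀ y c, F y c = FunctionSpaces.Torus.divergence (Q c) y) →
      Torus.eContDiffHolderNorm N α (BDSV.biotSavart F) ≤ C * ∑ c, Torus.eContDiffHolderNorm N α (Q c) := by
  obtain ⟨C, hC⟩ := hCZ.rieszHessian_le hα hα1 N
  refine ⟨18 * C, fun F Q hF hQ hFQ => ?_⟩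
  have hI : IsSmooth (FunctionSpaces.Torus.invLaplacian F) := isSmooth_invLaplacian hF
  have hcI : IsSmooth (BDSV.curl (FunctionSpaces.Torus.invLaplacian F)) := isSmooth_curl hI
  -- `∂_b (Δ⁻¹F)_c = ∑_k R_{bk} Q_c^k`
  have hentry : ∀ b c, (fun x => FunctionSpaces.Torus.partialDeriv b (FunctionSpaces.Torus.invLaplacian F) x c) =
      fun x => ∑ k, rieszHessian b k (fun y => Q c y k) x := by
    intro b c
    have hFc : (fun y => F y c) = FunctionSpaces.Torus.divergence (Q c) := funext fun y => hFQ y c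
    funext x
    rw [← partialDeriv_apply_coord (hI.isContDiff (by simp)) b x c, invLaplacian_apply_coord hF c, hFc,
      partialDeriv_invLaplacian_divergence (hQ c) b]
  have hentry_le : ∀ b c, Torus.eContDiffHolderNorm N α
      (fun x => FunctionSpaces.Torus.partialDeriv b (FunctionSpaces.Torus.invLaplacian F) x c) ≤ 3 * C * Torus.eContDiffHolderNorm N α (Q c) := by
    intro b c
    rw [hentry b c]
    have hfun : (fun x => ∑ k, rieszHessian b k (fun y => Q c y k) x) = ∑ k, rieszHessian b k (fun y => Q c y k) := by
      funext x; simp only [Finset.sum_apply]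
    rw [hfun]
    calc Torus.eContDiffHolderNorm N α (∑ k, rieszHessian b k (fun y => Q c y k))
        ≤ ∑ k, Torus.eContDiffHolderNorm N α (rieszHessian b k (fun y => Q c y k)) :=
          Torus.eContDiffHolderNorm_sum_le Finset.univ fun k _ =>
            isContDiff_nat_of_isSmooth (isSmooth_rieszHessian ((hQ c).apply k) b k) N
      _ ≤ ∑ _k : Fin 3, (C : ℝ≥0∞) * Torus.eContDiffHolderNorm N α (Q c) :=
          Finset.sum_le_sum fun k _ => (hC b k _ ((hQ c).apply k)).trans
            (mul_le_mul' le_rfl (eContDiffHolderNorm_coord_le (hQ c) N α k))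
      _ = 3 * C * Torus.eContDiffHolderNorm N α (Q c) := by
          simp only [Finset.sum_const, Finset.card_univ, Fintype.card_fin, nsmul_eq_mul]
          push_cast
          ring
  -- the components of `curl Δ⁻¹F`
  have hsumQ : ∀ c, Torus.eContDiffHolderNorm N α (Q c) ≤ ∑ c', Torus.eContDiffHolderNorm N α (Q c') := fun c =>
    Finset.single_le_sum (f := fun c' => Torus.eContDiffHolderNorm N α (Q c')) (fun _ _ => bot_le) (Finset.mem_univ c)
  have hcomp : ∀ (a b c e : Fin 3), (∀ y, BDSV.curl (FunctionSpaces.Torus.invLaplacian F) y a =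
      FunctionSpaces.Torus.partialDeriv b (FunctionSpaces.Torus.invLaplacian F) y c - FunctionSpaces.Torus.partialDeriv e (FunctionSpaces.Torus.invLaplacian F) y b) →
      Torus.eContDiffHolderNorm N α (fun x => BDSV.curl (FunctionSpaces.Torus.invLaplacian F) x a) ≤
        3 * C * ∑ c', Torus.eContDiffHolderNorm N α (Q c') + 3 * C * ∑ c', Torus.eContDiffHolderNorm N α (Q c') := by
    intro a b c e hform
    have hDN : ∀ b c, IsContDiff N (fun x => FunctionSpaces.Torus.partialDeriv b (FunctionSpaces.Torus.invLaplacian F) x c) := fun b c =>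
      (((hI.partialDeriv b).apply c)).isContDiff (by exact_mod_cast le_top)
    rw [show (fun x => BDSV.curl (FunctionSpaces.Torus.invLaplacian F) x a) =
        (fun x => FunctionSpaces.Torus.partialDeriv b (FunctionSpaces.Torus.invLaplacian F) x c) -
          fun x => FunctionSpaces.Torus.partialDeriv e (FunctionSpaces.Torus.invLaplacian F) x b from funext fun x => by
        rw [Pi.sub_apply]; exact hform x]
    refine (Torus.eContDiffHolderNorm_sub_le (hDN b c) (hDN e b)).trans (add_le_add ?_ ?_)
    · exact (hentry_le b c).trans (mul_le_mul' le_rfl (hsumQ c))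
    · exact (hentry_le e b).trans (mul_le_mul' le_rfl (hsumQ b))
  rw [biotSavart_eq_neg_curl_invLaplacian hF, show (fun x => -BDSV.curl (FunctionSpaces.Torus.invLaplacian F) x) =
      -BDSV.curl (FunctionSpaces.Torus.invLaplacian F) from rfl, Torus.eContDiffHolderNorm_neg]
  calc Torus.eContDiffHolderNorm N α (BDSV.curl (FunctionSpaces.Torus.invLaplacian F))
      ≤ ∑ a, Torus.eContDiffHolderNorm N α (fun x => BDSV.curl (FunctionSpaces.Torus.invLaplacian F) x a) :=
        eContDiffHolderNorm_le_sum_coord hcI N α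
    _ ≤ ∑ _a : Fin 3, (3 * C * ∑ c', Torus.eContDiffHolderNorm N α (Q c') + 3 * C * ∑ c', Torus.eContDiffHolderNorm N α (Q c')) := by
        rw [Fin.sum_univ_three, Fin.sum_univ_three]
        exact add_le_add (add_le_add (hcomp 0 1 2 2 fun y => curl_apply_zero _ y) (hcomp 1 2 0 0 fun y => curl_apply_one _ y))
          (hcomp 2 0 1 1 fun y => curl_apply_two _ y)
    _ = ((18 * C : ℝ≥0) : ℝ≥0∞) * ∑ c', Torus.eContDiffHolderNorm N α (Q c') := by
        rw [Finset.sum_const, Finset.card_univ, Fintype.card_fin, nsmul_eq_mul]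
        push_cast
        ring

/-- **`∇Δ⁻¹div` is an operator of order zero on `C^{N,α}(𝕋³)`**: from `BDSV.holderCZBound`, for
`0 < α < 1` and `N` there is `C` with `‖∇Δ⁻¹(div P)‖_{N,α} ≤ C‖P‖_{N,α}` for smooth `P`
(`∂ₘΔ⁻¹div P = ∑_k ∂ₘ∂_kΔ⁻¹P_k`). [cite: Derosa2018, §5.2 proof of Prop. 5.4 ((5.28))] -/
theorem holderCZBound.gradient_invLaplacian_divergence_le (hCZ : holderCZBound) {α : ℝ≥0} (hα : 0 < α)
    (hα1 : α < 1) (N : ℕ) :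
    ∃ C : ℝ≥0, ∀ (P : UnitAddTorus (Fin 3) → EuclideanSpace ℝ (Fin 3)), IsSmooth P →
      Torus.eContDiffHolderNorm N α (Torus.gradient (FunctionSpaces.Torus.invLaplacian (FunctionSpaces.Torus.divergence P))) ≤
        C * Torus.eContDiffHolderNorm N α P := by
  obtain ⟨C, hC⟩ := hCZ.rieszHessian_le hα hα1 N
  refine ⟨9 * C, fun P hP => ?_⟩
  have hdP : IsSmooth (FunctionSpaces.Torus.divergence P) := hP.divergence
  have hI : IsSmooth (FunctionSpaces.Torus.invLaplacian (FunctionSpaces.Torus.divergence P)) := isSmooth_invLaplacian hdP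
  have hpm : ∀ m, Torus.eContDiffHolderNorm N α (FunctionSpaces.Torus.partialDeriv m (FunctionSpaces.Torus.invLaplacian (FunctionSpaces.Torus.divergence P))) ≤
      3 * C * Torus.eContDiffHolderNorm N α P := by
    intro m
    rw [partialDeriv_invLaplacian_divergence hP m]
    have hfun : (fun x => ∑ k, rieszHessian m k (fun y => P y k) x) = ∑ k, rieszHessian m k (fun y => P y k) := by
      funext x; simp only [Finset.sum_apply]
    rw [hfun]
    calc Torus.eContDiffHolderNorm N α (∑ k, rieszHessian m k (fun y => P y k))
        ≤ ∑ k, Torus.eContDiffHolderNorm N α (rieszHessian m k (fun y => P y k)) :=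
          Torus.eContDiffHolderNorm_sum_le Finset.univ fun k _ =>
            isContDiff_nat_of_isSmooth (isSmooth_rieszHessian (hP.apply k) m k) N
      _ ≤ ∑ _k : Fin 3, (C : ℝ≥0∞) * Torus.eContDiffHolderNorm N α P :=
          Finset.sum_le_sum fun k _ => (hC m k _ (hP.apply k)).trans
            (mul_le_mul' le_rfl (eContDiffHolderNorm_coord_le hP N α k))
      _ = 3 * C * Torus.eContDiffHolderNorm N α P := by
          simp only [Finset.sum_const, Finset.card_univ, Fintype.card_fin, nsmul_eq_mul]
          push_cast
          ring
  calc Torus.eContDiffHolderNorm N α (Torus.gradient (FunctionSpaces.Torus.invLaplacian (FunctionSpaces.Torus.divergence P)))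
      ≤ ∑ m, Torus.eContDiffHolderNorm N α (FunctionSpaces.Torus.partialDeriv m (FunctionSpaces.Torus.invLaplacian (FunctionSpaces.Torus.divergence P))) :=
        eContDiffHolderNorm_gradient_le_sum hI N α
    _ ≤ ∑ _m : Fin 3, 3 * (C : ℝ≥0∞) * Torus.eContDiffHolderNorm N α P := Finset.sum_le_sum fun m _ => hpm m
    _ = ((9 * C : ℝ≥0) : ℝ≥0∞) * Torus.eContDiffHolderNorm N α P := by
        simp only [Finset.sum_const, Finset.card_univ, Fintype.card_fin, nsmul_eq_mul]
        push_cast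
        ring

/-! ## Products -/

/-- **Leibniz bound for a scalar times a vector field**: `‖f g‖_{N,r} ≤ 3ᴺ ∑_{j≤N} ‖f‖_{j,r}‖g‖_{N-j,r}`. [folklore] -/
theorem eContDiffHolderNorm_smul_le_sum {d : Type} [Fintype d] {F : Type} [NormedAddCommGroup F] [NormedSpace ℝ F]
    {f : UnitAddTorus d → ℝ} {g : UnitAddTorus d → F} {N : ℕ} (hf : IsContDiff N f) (hg : IsContDiff N g) (r : ℝ≥0) :
    Torus.eContDiffHolderNorm N r (fun y => f y • g y) ≤
      3 ^ N * ∑ j ∈ Finset.range (N + 1), Torus.eContDiffHolderNorm j r f * Torus.eContDiffHolderNorm (N - j) r g := by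
  have h := Torus.eContDiffHolderNorm_bilinear_le (ContinuousLinearMap.lsmul ℝ ℝ : ℝ →L[ℝ] F →L[ℝ] F) hf hg r
  have h1 : ‖(ContinuousLinearMap.lsmul ℝ ℝ : ℝ →L[ℝ] F →L[ℝ] F)‖ₑ ≤ 1 := by
    rw [← ofReal_norm, ← ENNReal.ofReal_one]
    exact ENNReal.ofReal_le_ofReal ContinuousLinearMap.opNorm_lsmul_le
  refine h.trans ?_
  calc (3 : ℝ≥0∞) ^ N * ‖(ContinuousLinearMap.lsmul ℝ ℝ : ℝ →L[ℝ] F →L[ℝ] F)‖ₑ *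
        ∑ j ∈ Finset.range (N + 1), Torus.eContDiffHolderNorm j r f * Torus.eContDiffHolderNorm (N - j) r g
      ≤ 3 ^ N * 1 * ∑ j ∈ Finset.range (N + 1), Torus.eContDiffHolderNorm j r f * Torus.eContDiffHolderNorm (N - j) r g :=
        mul_le_mul' (mul_le_mul' le_rfl h1) le_rfl
    _ = _ := by rw [mul_one]

/-! ## The divergence structures -/

section Structures

variable {Z u v : UnitAddTorus (Fin 3) → EuclideanSpace ℝ (Fin 3)} {R : UnitAddTorus (Fin 3) → Fin 3 → EuclideanSpace ℝ (Fin 3)}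

/-- **`((curl Z)·∇)v = div((Z×∇)vᵀ)`** in coordinates: `(((curl Z)·∇)v)_c = div(Z × ∇v_c)`.
[cite: Derosa2018, §5.2 proof of Prop. 5.4] -/
theorem convect_curl_apply_eq_divergence (hZ : IsSmooth Z) (hv : IsSmooth v) (y : UnitAddTorus (Fin 3)) (c : Fin 3) :
    FunctionSpaces.Torus.convect (BDSV.curl Z) v y c =
      FunctionSpaces.Torus.divergence (fun y => WithLp.toLp 2
        ![Z y 1 * FunctionSpaces.Torus.partialDeriv 2 (fun z => v z c) y - Z y 2 * FunctionSpaces.Torus.partialDeriv 1 (fun z => v z c) y,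
          Z y 2 * FunctionSpaces.Torus.partialDeriv 0 (fun z => v z c) y - Z y 0 * FunctionSpaces.Torus.partialDeriv 2 (fun z => v z c) y,
          Z y 0 * FunctionSpaces.Torus.partialDeriv 1 (fun z => v z c) y - Z y 1 * FunctionSpaces.Torus.partialDeriv 0 (fun z => v z c) y]) y := by
  rw [convect_apply_coord_sum (hv.isContDiff (by simp)) y c, ← sum_curl_mul_partialDeriv_eq_divergence hZ (hv.apply c) y]
  refine Finset.sum_congr rfl fun j _ => ?_
  rw [partialDeriv_apply_coord (hv.isContDiff (by simp)) j y c]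

/-- The coordinates of `div R̊`: `(div R̊)_c = div(y ↦ (R̊(y)_{jc})_j)`. [folklore] -/
theorem tensorDivergence_apply_eq_divergence (hR : IsSmooth R) (y : UnitAddTorus (Fin 3)) (c : Fin 3) :
    Torus.tensorDivergence R y c =
      FunctionSpaces.Torus.divergence (fun y => (WithLp.toLp 2 (fun j => R y j c) : EuclideanSpace ℝ (Fin 3))) y := by
  rw [Torus.tensorDivergence, FunctionSpaces.Torus.divergence]
  simp only [WithLp.ofLp_sum, Finset.sum_apply]
  refine Finset.sum_congr rfl fun j _ => ?_
  rw [← partialDeriv_apply_coord ((hR.column j).isContDiff (by simp)) j y c]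

/-- **The correction `C₁ = curl((u·∇)Z) - (u·∇)curl Z` is a divergence** for `div u = 0`:
`(C₁)_a = div(Z_c ∂_b u - Z_b ∂_c u)` (`(a,b,c)` cyclic). [cite: Derosa2018, §5.2 proof of Prop. 5.4] -/
theorem curl_convect_sub_apply_eq_divergence (hu : IsSmooth u) (hdiv : IsDivFree u) (hZ : IsSmooth Z)
    (y : UnitAddTorus (Fin 3)) (a : Fin 3) :
    BDSV.curl (FunctionSpaces.Torus.convect u Z) y a - FunctionSpaces.Torus.convect u (BDSV.curl Z) y a =
      FunctionSpaces.Torus.divergence (![(fun y => Z y 2 • FunctionSpaces.Torus.partialDeriv 1 u y) - fun y => Z y 1 • FunctionSpaces.Torus.partialDeriv 2 u y,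
        (fun y => Z y 0 • FunctionSpaces.Torus.partialDeriv 2 u y) - fun y => Z y 2 • FunctionSpaces.Torus.partialDeriv 0 u y,
        (fun y => Z y 1 • FunctionSpaces.Torus.partialDeriv 0 u y) - fun y => Z y 0 • FunctionSpaces.Torus.partialDeriv 1 u y] a) y := by
  have hprod : ∀ b c, IsContDiff 1 (fun y => Z y c • FunctionSpaces.Torus.partialDeriv b u y) := fun b c =>
    ((hZ.apply c).smul' (hu.partialDeriv b)).isContDiff (by simp)
  have key : ∀ b c, FunctionSpaces.Torus.convect (FunctionSpaces.Torus.partialDeriv b u) Z y c =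
      FunctionSpaces.Torus.divergence (fun y => Z y c • FunctionSpaces.Torus.partialDeriv b u y) y := fun b c =>
    convect_partialDeriv_apply_eq_divergence hu hdiv hZ b c y
  rw [curl_convect hu hZ y, PiLp.add_apply, add_sub_cancel_left]
  fin_cases a
  · simp only [Fin.zero_eta, Fin.isValue, Matrix.cons_val_zero]
    rw [FunctionSpaces.Torus.divergence_sub (hprod 1 2) (hprod 2 1), ← key, ← key]
  · simp only [Fin.mk_one, Fin.isValue, Matrix.cons_val_one, Matrix.cons_val_zero]
    rw [FunctionSpaces.Torus.divergence_sub (hprod 2 0) (hprod 0 2), ← key, ← key]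
  · simp only [Fin.reduceFinMk, Fin.isValue, Matrix.cons_val]
    rw [FunctionSpaces.Torus.divergence_sub (hprod 0 1) (hprod 1 0), ← key, ← key]

end Structures

/-! ## The forcing bound (5.28) -/

section Forcing

variable {Z u v : UnitAddTorus (Fin 3) → EuclideanSpace ℝ (Fin 3)} {R : UnitAddTorus (Fin 3) → Fin 3 → EuclideanSpace ℝ (Fin 3)}
  {α : ℝ≥0} {N : ℕ}

/-- A column entry of a tensor field is dominated by the field: `‖R_{jc}‖_{N,α} ≤ ‖R‖_{N,α}`. [folklore] -/
theorem eContDiffHolderNorm_entry_le (hR : IsSmooth R) (N : ℕ) (α : ℝ≥0) (j c : Fin 3) :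
    Torus.eContDiffHolderNorm N α (fun y => R y j c) ≤ Torus.eContDiffHolderNorm N α R := by
  refine (eContDiffHolderNorm_coord_le (hR.column j) N α c).trans ?_
  have h := Torus.eContDiffHolderNorm_clm_comp_le
    (ContinuousLinearMap.proj (R := ℝ) (φ := fun _ : Fin 3 => EuclideanSpace ℝ (Fin 3)) j) (isContDiff_nat_of_isSmooth hR N) α
  have h1 : ‖(ContinuousLinearMap.proj (R := ℝ) (φ := fun _ : Fin 3 => EuclideanSpace ℝ (Fin 3)) j)‖ₑ ≤ 1 := by
    rw [← ofReal_norm, ← ENNReal.ofReal_one]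
    refine ENNReal.ofReal_le_ofReal (ContinuousLinearMap.opNorm_le_bound _ zero_le_one fun z => ?_)
    rw [one_mul]
    exact norm_le_pi_norm z j
  calc Torus.eContDiffHolderNorm N α (fun y => R y j) ≤ _ := h
    _ ≤ 1 * Torus.eContDiffHolderNorm N α R := mul_le_mul' h1 le_rfl
    _ = _ := one_mul _

/-- **The product `Z_i ∂_k v_c`**: `‖Z_i ∂_kv_c‖_{N,α} ≤ 3ᴺ ∑_{j≤N} ‖Z‖_{j,α}‖v‖_{N-j+1,α}`. [folklore] -/
theorem eContDiffHolderNorm_coord_mul_partialDeriv_le (hZ : IsSmooth Z) (hv : IsSmooth v) (N : ℕ) (α : ℝ≥0) (i k c : Fin 3) :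
    Torus.eContDiffHolderNorm N α (fun y => Z y i * FunctionSpaces.Torus.partialDeriv k (fun z => v z c) y) ≤
      3 ^ N * ∑ j ∈ Finset.range (N + 1), Torus.eContDiffHolderNorm j α Z * Torus.eContDiffHolderNorm (N - j + 1) α v := by
  have hZi : IsSmooth (fun y => Z y i) := hZ.apply i
  have hvc : IsSmooth (fun z => v z c) := hv.apply c
  have hD : IsSmooth (FunctionSpaces.Torus.partialDeriv k (fun z => v z c)) := hvc.partialDeriv k
  refine (eContDiffHolderNorm_smul_le_sum (f := fun y => Z y i) (g := FunctionSpaces.Torus.partialDeriv k (fun z => v z c))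
    (isContDiff_nat_of_isSmooth hZi N) (isContDiff_nat_of_isSmooth hD N) α).trans ?_
  refine mul_le_mul' le_rfl (Finset.sum_le_sum fun j hj => ?_)
  refine mul_le_mul' (eContDiffHolderNorm_coord_le hZ j α i) ?_
  calc Torus.eContDiffHolderNorm (N - j) α (FunctionSpaces.Torus.partialDeriv k (fun z => v z c))
      ≤ Torus.eContDiffHolderNorm (N - j + 1) α (fun z => v z c) :=
        Torus.eContDiffHolderNorm_partialDeriv_le (isContDiff_nat_of_isSmooth hvc (N - j + 1)) k α
    _ ≤ Torus.eContDiffHolderNorm (N - j + 1) α v := eContDiffHolderNorm_coord_le hv (N - j + 1) α c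

/-- **The product `Z_c ∂_b u`**: `‖Z_c ∂_bu‖_{N,α} ≤ 3ᴺ ∑_{j≤N} ‖Z‖_{j,α}‖u‖_{N-j+1,α}`. [folklore] -/
theorem eContDiffHolderNorm_coord_smul_partialDeriv_le (hZ : IsSmooth Z) (hu : IsSmooth u) (N : ℕ) (α : ℝ≥0) (b c : Fin 3) :
    Torus.eContDiffHolderNorm N α (fun y => Z y c • FunctionSpaces.Torus.partialDeriv b u y) ≤
      3 ^ N * ∑ j ∈ Finset.range (N + 1), Torus.eContDiffHolderNorm j α Z * Torus.eContDiffHolderNorm (N - j + 1) α u := by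
  have hZc : IsSmooth (fun y => Z y c) := hZ.apply c
  have hD : IsSmooth (FunctionSpaces.Torus.partialDeriv b u) := hu.partialDeriv b
  refine (eContDiffHolderNorm_smul_le_sum (isContDiff_nat_of_isSmooth hZc N) (isContDiff_nat_of_isSmooth hD N) α).trans ?_
  refine mul_le_mul' le_rfl (Finset.sum_le_sum fun j hj => ?_)
  exact mul_le_mul' (eContDiffHolderNorm_coord_le hZ j α c)
    (Torus.eContDiffHolderNorm_partialDeriv_le (isContDiff_nat_of_isSmooth hu (N - j + 1)) b α)

/-- **The forcing bound (5.28)** ("using that `-Δ⁻¹curl div` and `Δ⁻¹∇div` are bounded operators of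
order zero on Hölder spaces, `‖(∂ₜ + v_ℓ·∇ + ν(-Δ)^γ)z̃ᵢ‖_{N+α} ≲ ‖v‖_{1+α}‖z̃ᵢ‖_{N+α} + ‖v‖_{N+1+α}‖z̃ᵢ‖_α + ‖R̊_ℓ‖_{N+α}`"):
from `BDSV.holderCZBound`, for `0 < α < 1` and `N` there is `C` such that for smooth `Z, v, R̊` and
smooth divergence-free `u` the right-hand side of `DeRosa.fracPotential_transport_eq` (with
`w = curl Z`) obeys
`‖-ℬ((curl Z·∇)v) - ℬ(div R̊) + ℬ(curl((u·∇)Z) - (u·∇)curl Z) + ∇Δ⁻¹div((Z·∇)u)‖_{N,α}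
  ≤ C (3ᴺ ∑_{j≤N} ‖Z‖_{j,α}(‖v‖_{N-j+1,α} + ‖u‖_{N-j+1,α}) + ‖R̊‖_{N,α})`. [cite: Derosa2018, §5.2 proof of Prop. 5.4 ((5.28))] -/
theorem holderCZBound.fracPotential_rhs_le (hCZ : holderCZBound) {α : ℝ≥0} (hα : 0 < α) (hα1 : α < 1) (N : ℕ) :
    ∃ C : ℝ≥0, ∀ {Z u v : UnitAddTorus (Fin 3) → EuclideanSpace ℝ (Fin 3)}
      {R : UnitAddTorus (Fin 3) → Fin 3 → EuclideanSpace ℝ (Fin 3)},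
      IsSmooth Z → IsSmooth u → IsDivFree u → IsSmooth v → IsSmooth R →
      Torus.eContDiffHolderNorm N α (fun x =>
        -(BDSV.biotSavart (FunctionSpaces.Torus.convect (BDSV.curl Z) v) x) - BDSV.biotSavart (Torus.tensorDivergence R) x +
          BDSV.biotSavart (fun y => BDSV.curl (FunctionSpaces.Torus.convect u Z) y - FunctionSpaces.Torus.convect u (BDSV.curl Z) y) x +
          Torus.gradient (FunctionSpaces.Torus.invLaplacian (FunctionSpaces.Torus.divergence (FunctionSpaces.Torus.convect Z u))) x) ≤
      C * (3 ^ N * ∑ j ∈ Finset.range (N + 1), Torus.eContDiffHolderNorm j α Z *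
          (Torus.eContDiffHolderNorm (N - j + 1) α v + Torus.eContDiffHolderNorm (N - j + 1) α u) +
        Torus.eContDiffHolderNorm N α R) := by
  obtain ⟨C₁, hB⟩ := hCZ.biotSavart_divStructure_le hα hα1 N
  obtain ⟨C₂, hG⟩ := hCZ.gradient_invLaplacian_divergence_le hα hα1 N
  refine ⟨27 * C₁ + C₂, ?_⟩
  intro Z u v R hZ hu hdiv hv hR
  -- abbreviations for the sums
  set Sv : ℝ≥0∞ := ∑ j ∈ Finset.range (N + 1), Torus.eContDiffHolderNorm j α Z * Torus.eContDiffHolderNorm (N - j + 1) α v with hSv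
  set Su : ℝ≥0∞ := ∑ j ∈ Finset.range (N + 1), Torus.eContDiffHolderNorm j α Z * Torus.eContDiffHolderNorm (N - j + 1) α u with hSu
  set S : ℝ≥0∞ := ∑ j ∈ Finset.range (N + 1), Torus.eContDiffHolderNorm j α Z *
    (Torus.eContDiffHolderNorm (N - j + 1) α v + Torus.eContDiffHolderNorm (N - j + 1) α u) with hS
  have hSvS : Sv ≤ S := Finset.sum_le_sum fun j _ => mul_le_mul' le_rfl le_self_add
  have hSuS : Su ≤ S := Finset.sum_le_sum fun j _ => mul_le_mul' le_rfl le_add_self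
  have hw : IsSmooth (BDSV.curl Z) := isSmooth_curl hZ
  -- T1: `ℬ((curl Z·∇)v)`
  set Q₁ : Fin 3 → UnitAddTorus (Fin 3) → EuclideanSpace ℝ (Fin 3) := fun c y => WithLp.toLp 2
    ![Z y 1 * FunctionSpaces.Torus.partialDeriv 2 (fun z => v z c) y - Z y 2 * FunctionSpaces.Torus.partialDeriv 1 (fun z => v z c) y,
      Z y 2 * FunctionSpaces.Torus.partialDeriv 0 (fun z => v z c) y - Z y 0 * FunctionSpaces.Torus.partialDeriv 2 (fun z => v z c) y,
      Z y 0 * FunctionSpaces.Torus.partialDeriv 1 (fun z => v z c) y - Z y 1 * FunctionSpaces.Torus.partialDeriv 0 (fun z => v z c) y] with hQ₁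
  have hP : ∀ i k c, IsSmooth (fun y => Z y i * FunctionSpaces.Torus.partialDeriv k (fun z => v z c) y) := fun i k c =>
    (hZ.apply i).smul' ((hv.apply c).partialDeriv k)
  have hQ₁s : ∀ c, IsSmooth (Q₁ c) := fun c =>
    DeRosa.isSmooth_vec3 ((hP 1 2 c).sub (hP 2 1 c)) ((hP 2 0 c).sub (hP 0 2 c)) ((hP 0 1 c).sub (hP 1 0 c))
  have hF₁s : IsSmooth (FunctionSpaces.Torus.convect (BDSV.curl Z) v) := hw.convect hv
  have hF₁Q : ∀ y c, FunctionSpaces.Torus.convect (BDSV.curl Z) v y c = FunctionSpaces.Torus.divergence (Q₁ c) y := fun y c =>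
    convect_curl_apply_eq_divergence hZ hv y c
  have hPb := eContDiffHolderNorm_coord_mul_partialDeriv_le hZ hv N α
  have hQ₁b : ∀ c, Torus.eContDiffHolderNorm N α (Q₁ c) ≤ 6 * (3 ^ N * Sv) := by
    intro c
    have hcomp : ∀ (i k i' k' : Fin 3), Torus.eContDiffHolderNorm N α
        (fun y => Z y i * FunctionSpaces.Torus.partialDeriv k (fun z => v z c) y - Z y i' * FunctionSpaces.Torus.partialDeriv k' (fun z => v z c) y) ≤
        3 ^ N * Sv + 3 ^ N * Sv := by
      intro i k i' k'
      rw [show (fun y => Z y i * FunctionSpaces.Torus.partialDeriv k (fun z => v z c) y - Z y i' * FunctionSpaces.Torus.partialDeriv k' (fun z => v z c) y) =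
        (fun y => Z y i * FunctionSpaces.Torus.partialDeriv k (fun z => v z c) y) - fun y => Z y i' * FunctionSpaces.Torus.partialDeriv k' (fun z => v z c) y from rfl]
      exact (Torus.eContDiffHolderNorm_sub_le (isContDiff_nat_of_isSmooth (hP i k c) N) (isContDiff_nat_of_isSmooth (hP i' k' c) N)).trans
        (add_le_add (hPb i k c) (hPb i' k' c))
    have e0 : (fun y => Q₁ c y 0) = fun y => Z y 1 * FunctionSpaces.Torus.partialDeriv 2 (fun z => v z c) y - Z y 2 * FunctionSpaces.Torus.partialDeriv 1 (fun z => v z c) y := by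
      funext y; simp [hQ₁]
    have e1 : (fun y => Q₁ c y 1) = fun y => Z y 2 * FunctionSpaces.Torus.partialDeriv 0 (fun z => v z c) y - Z y 0 * FunctionSpaces.Torus.partialDeriv 2 (fun z => v z c) y := by
      funext y; simp [hQ₁]
    have e2 : (fun y => Q₁ c y 2) = fun y => Z y 0 * FunctionSpaces.Torus.partialDeriv 1 (fun z => v z c) y - Z y 1 * FunctionSpaces.Torus.partialDeriv 0 (fun z => v z c) y := by
      funext y; simp [hQ₁]
    calc Torus.eContDiffHolderNorm N α (Q₁ c) ≤ ∑ a, Torus.eContDiffHolderNorm N α (fun y => Q₁ c y a) :=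
          eContDiffHolderNorm_le_sum_coord (hQ₁s c) N α
      _ ≤ (3 ^ N * Sv + 3 ^ N * Sv) + (3 ^ N * Sv + 3 ^ N * Sv) + (3 ^ N * Sv + 3 ^ N * Sv) := by
          rw [Fin.sum_univ_three, e0, e1, e2]
          exact add_le_add (add_le_add (hcomp 1 2 2 1) (hcomp 2 0 0 2)) (hcomp 0 1 1 0)
      _ = 6 * (3 ^ N * Sv) := by ring
  have hT1 : Torus.eContDiffHolderNorm N α (BDSV.biotSavart (FunctionSpaces.Torus.convect (BDSV.curl Z) v)) ≤ C₁ * (18 * (3 ^ N * Sv)) := by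
    refine (hB _ Q₁ hF₁s hQ₁s hF₁Q).trans (mul_le_mul' le_rfl ?_)
    calc ∑ c, Torus.eContDiffHolderNorm N α (Q₁ c) ≤ ∑ _c : Fin 3, 6 * (3 ^ N * Sv) := Finset.sum_le_sum fun c _ => hQ₁b c
      _ = 18 * (3 ^ N * Sv) := by
          rw [Finset.sum_const, Finset.card_univ, Fintype.card_fin, nsmul_eq_mul]; push_cast; ring
  -- T2: `ℬ(div R̊)`
  set Q₂ : Fin 3 → UnitAddTorus (Fin 3) → EuclideanSpace ℝ (Fin 3) := fun c y => WithLp.toLp 2 (fun j => R y j c) with hQ₂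
  have hQ₂s : ∀ c, IsSmooth (Q₂ c) := fun c =>
    Torus.isSmooth_euclidean_iff.2 fun j => by simpa [hQ₂] using (hR.column j).apply c
  have hF₂s : IsSmooth (Torus.tensorDivergence R) := hR.tensorDivergence
  have hF₂Q : ∀ y c, Torus.tensorDivergence R y c = FunctionSpaces.Torus.divergence (Q₂ c) y := fun y c =>
    tensorDivergence_apply_eq_divergence hR y c
  have hQ₂b : ∀ c, Torus.eContDiffHolderNorm N α (Q₂ c) ≤ 3 * Torus.eContDiffHolderNorm N α R := by
    intro c
    calc Torus.eContDiffHolderNorm N α (Q₂ c) ≤ ∑ j, Torus.eContDiffHolderNorm N α (fun y => Q₂ c y j) :=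
          eContDiffHolderNorm_le_sum_coord (hQ₂s c) N α
      _ ≤ ∑ _j : Fin 3, Torus.eContDiffHolderNorm N α R := Finset.sum_le_sum fun j _ => by
          have e : (fun y => Q₂ c y j) = fun y => R y j c := by funext y; simp [hQ₂]
          rw [e]; exact eContDiffHolderNorm_entry_le hR N α j c
      _ = 3 * Torus.eContDiffHolderNorm N α R := by
          rw [Finset.sum_const, Finset.card_univ, Fintype.card_fin, nsmul_eq_mul]; push_cast; ring
  have hT2 : Torus.eContDiffHolderNorm N α (BDSV.biotSavart (Torus.tensorDivergence R)) ≤ C₁ * (9 * Torus.eContDiffHolderNorm N α R) := by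
    refine (hB _ Q₂ hF₂s hQ₂s hF₂Q).trans (mul_le_mul' le_rfl ?_)
    calc ∑ c, Torus.eContDiffHolderNorm N α (Q₂ c) ≤ ∑ _c : Fin 3, 3 * Torus.eContDiffHolderNorm N α R := Finset.sum_le_sum fun c _ => hQ₂b c
      _ = 9 * Torus.eContDiffHolderNorm N α R := by
          rw [Finset.sum_const, Finset.card_univ, Fintype.card_fin, nsmul_eq_mul]; push_cast; ring
  -- T3: `ℬ(C₁)`
  set Q₃ : Fin 3 → UnitAddTorus (Fin 3) → EuclideanSpace ℝ (Fin 3) :=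
    ![(fun y => Z y 2 • FunctionSpaces.Torus.partialDeriv 1 u y) - fun y => Z y 1 • FunctionSpaces.Torus.partialDeriv 2 u y,
      (fun y => Z y 0 • FunctionSpaces.Torus.partialDeriv 2 u y) - fun y => Z y 2 • FunctionSpaces.Torus.partialDeriv 0 u y,
      (fun y => Z y 1 • FunctionSpaces.Torus.partialDeriv 0 u y) - fun y => Z y 0 • FunctionSpaces.Torus.partialDeriv 1 u y] with hQ₃
  have hPu : ∀ b c, IsSmooth (fun y => Z y c • FunctionSpaces.Torus.partialDeriv b u y) := fun b c =>
    (hZ.apply c).smul' (hu.partialDeriv b)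
  have hPub := eContDiffHolderNorm_coord_smul_partialDeriv_le hZ hu N α
  have hdiff : ∀ (b c b' c' : Fin 3), IsSmooth ((fun y => Z y c • FunctionSpaces.Torus.partialDeriv b u y) - fun y => Z y c' • FunctionSpaces.Torus.partialDeriv b' u y) ∧
      Torus.eContDiffHolderNorm N α ((fun y => Z y c • FunctionSpaces.Torus.partialDeriv b u y) - fun y => Z y c' • FunctionSpaces.Torus.partialDeriv b' u y) ≤
        3 ^ N * Su + 3 ^ N * Su := fun b c b' c' =>
    ⟨(hPu b c).sub (hPu b' c'), (Torus.eContDiffHolderNorm_sub_le (isContDiff_nat_of_isSmooth (hPu b c) N)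
      (isContDiff_nat_of_isSmooth (hPu b' c') N)).trans (add_le_add (hPub b c) (hPub b' c'))⟩
  have hQ₃s : ∀ a, IsSmooth (Q₃ a) := by
    intro a
    fin_cases a
    · simpa [hQ₃] using (hdiff 1 2 2 1).1
    · simpa [hQ₃] using (hdiff 2 0 0 2).1
    · simpa [hQ₃] using (hdiff 0 1 1 0).1
  have hQ₃b : ∀ a, Torus.eContDiffHolderNorm N α (Q₃ a) ≤ 3 ^ N * Su + 3 ^ N * Su := by
    intro a
    fin_cases a
    · simpa [hQ₃] using (hdiff 1 2 2 1).2
    · simpa [hQ₃] using (hdiff 2 0 0 2).2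
    · simpa [hQ₃] using (hdiff 0 1 1 0).2
  have hF₃s : IsSmooth (fun y => BDSV.curl (FunctionSpaces.Torus.convect u Z) y - FunctionSpaces.Torus.convect u (BDSV.curl Z) y) :=
    (isSmooth_curl (hu.convect hZ)).sub (hu.convect hw)
  have hF₃Q : ∀ y a, (BDSV.curl (FunctionSpaces.Torus.convect u Z) y - FunctionSpaces.Torus.convect u (BDSV.curl Z) y) a =
      FunctionSpaces.Torus.divergence (Q₃ a) y := fun y a => by
    rw [PiLp.sub_apply, curl_convect_sub_apply_eq_divergence hu hdiv hZ y a]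
  have hT3 : Torus.eContDiffHolderNorm N α (BDSV.biotSavart (fun y => BDSV.curl (FunctionSpaces.Torus.convect u Z) y - FunctionSpaces.Torus.convect u (BDSV.curl Z) y)) ≤
      C₁ * (6 * (3 ^ N * Su)) := by
    refine (hB _ Q₃ hF₃s hQ₃s hF₃Q).trans (mul_le_mul' le_rfl ?_)
    calc ∑ a, Torus.eContDiffHolderNorm N α (Q₃ a) ≤ ∑ _a : Fin 3, (3 ^ N * Su + 3 ^ N * Su) := Finset.sum_le_sum fun a _ => hQ₃b a
      _ = 6 * (3 ^ N * Su) := by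
          rw [Finset.sum_const, Finset.card_univ, Fintype.card_fin, nsmul_eq_mul]; push_cast; ring
  -- T4: `∇Δ⁻¹div((Z·∇)u)`
  have hF₄s : IsSmooth (FunctionSpaces.Torus.convect Z u) := hZ.convect hu
  have hT4 : Torus.eContDiffHolderNorm N α (Torus.gradient (FunctionSpaces.Torus.invLaplacian (FunctionSpaces.Torus.divergence (FunctionSpaces.Torus.convect Z u)))) ≤
      C₂ * (3 ^ N * Su) := by
    refine (hG _ hF₄s).trans (mul_le_mul' le_rfl ?_)
    exact Torus.eContDiffHolderNorm_convect_le (isContDiff_nat_of_isSmooth hZ N) (isContDiff_nat_of_isSmooth hu (N + 1)) α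
  -- assemble
  have hB1 : IsSmooth (BDSV.biotSavart (FunctionSpaces.Torus.convect (BDSV.curl Z) v)) := isSmooth_biotSavart hF₁s
  have hB2 : IsSmooth (BDSV.biotSavart (Torus.tensorDivergence R)) := isSmooth_biotSavart hF₂s
  have hB3 : IsSmooth (BDSV.biotSavart (fun y => BDSV.curl (FunctionSpaces.Torus.convect u Z) y - FunctionSpaces.Torus.convect u (BDSV.curl Z) y)) :=
    isSmooth_biotSavart hF₃s
  have hB4 : IsSmooth (Torus.gradient (FunctionSpaces.Torus.invLaplacian (FunctionSpaces.Torus.divergence (FunctionSpaces.Torus.convect Z u)))) :=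
    (isSmooth_invLaplacian hF₄s.divergence).gradient
  have hfun : (fun x => -(BDSV.biotSavart (FunctionSpaces.Torus.convect (BDSV.curl Z) v) x) - BDSV.biotSavart (Torus.tensorDivergence R) x +
      BDSV.biotSavart (fun y => BDSV.curl (FunctionSpaces.Torus.convect u Z) y - FunctionSpaces.Torus.convect u (BDSV.curl Z) y) x +
      Torus.gradient (FunctionSpaces.Torus.invLaplacian (FunctionSpaces.Torus.divergence (FunctionSpaces.Torus.convect Z u))) x) =
      ((-BDSV.biotSavart (FunctionSpaces.Torus.convect (BDSV.curl Z) v) - BDSV.biotSavart (Torus.tensorDivergence R)) +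
        BDSV.biotSavart (fun y => BDSV.curl (FunctionSpaces.Torus.convect u Z) y - FunctionSpaces.Torus.convect u (BDSV.curl Z) y)) +
        Torus.gradient (FunctionSpaces.Torus.invLaplacian (FunctionSpaces.Torus.divergence (FunctionSpaces.Torus.convect Z u))) := rfl
  rw [hfun]
  have c1 := isContDiff_nat_of_isSmooth hB1 N
  have c2 := isContDiff_nat_of_isSmooth hB2 N
  have c3 := isContDiff_nat_of_isSmooth hB3 N
  have c4 := isContDiff_nat_of_isSmooth hB4 N
  calc Torus.eContDiffHolderNorm N α (((-BDSV.biotSavart (FunctionSpaces.Torus.convect (BDSV.curl Z) v) - BDSV.biotSavart (Torus.tensorDivergence R)) +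
        BDSV.biotSavart (fun y => BDSV.curl (FunctionSpaces.Torus.convect u Z) y - FunctionSpaces.Torus.convect u (BDSV.curl Z) y)) +
        Torus.gradient (FunctionSpaces.Torus.invLaplacian (FunctionSpaces.Torus.divergence (FunctionSpaces.Torus.convect Z u))))
      ≤ ((Torus.eContDiffHolderNorm N α (BDSV.biotSavart (FunctionSpaces.Torus.convect (BDSV.curl Z) v)) +
          Torus.eContDiffHolderNorm N α (BDSV.biotSavart (Torus.tensorDivergence R))) +
          Torus.eContDiffHolderNorm N α (BDSV.biotSavart (fun y => BDSV.curl (FunctionSpaces.Torus.convect u Z) y - FunctionSpaces.Torus.convect u (BDSV.curl Z) y))) +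
          Torus.eContDiffHolderNorm N α (Torus.gradient (FunctionSpaces.Torus.invLaplacian (FunctionSpaces.Torus.divergence (FunctionSpaces.Torus.convect Z u)))) := by
        have c1n : IsContDiff N (-BDSV.biotSavart (FunctionSpaces.Torus.convect (BDSV.curl Z) v)) := c1.neg
        have c12 : IsContDiff N (-BDSV.biotSavart (FunctionSpaces.Torus.convect (BDSV.curl Z) v) - BDSV.biotSavart (Torus.tensorDivergence R)) :=
          c1n.sub c2
        have c123 : IsContDiff N ((-BDSV.biotSavart (FunctionSpaces.Torus.convect (BDSV.curl Z) v) - BDSV.biotSavart (Torus.tensorDivergence R)) +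
            BDSV.biotSavart (fun y => BDSV.curl (FunctionSpaces.Torus.convect u Z) y - FunctionSpaces.Torus.convect u (BDSV.curl Z) y)) :=
          c12.add c3
        refine (Torus.eContDiffHolderNorm_add_le c123 c4).trans (add_le_add ?_ le_rfl)
        refine (Torus.eContDiffHolderNorm_add_le c12 c3).trans (add_le_add ?_ le_rfl)
        refine (Torus.eContDiffHolderNorm_sub_le c1n c2).trans (add_le_add ?_ le_rfl)
        rw [Torus.eContDiffHolderNorm_neg]
    _ ≤ ((C₁ * (18 * (3 ^ N * Sv)) + C₁ * (9 * Torus.eContDiffHolderNorm N α R)) + C₁ * (6 * (3 ^ N * Su))) + C₂ * (3 ^ N * Su) :=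
        add_le_add (add_le_add (add_le_add hT1 hT2) hT3) hT4
    _ ≤ ((C₁ * (18 * (3 ^ N * S)) + C₁ * (9 * Torus.eContDiffHolderNorm N α R)) + C₁ * (6 * (3 ^ N * S))) + C₂ * (3 ^ N * S) := by
        gcongr
    _ ≤ ((27 * C₁ + C₂ : ℝ≥0) : ℝ≥0∞) * (3 ^ N * S + Torus.eContDiffHolderNorm N α R) := by
        push_cast
        have h9 : (C₁ : ℝ≥0∞) * (9 * Torus.eContDiffHolderNorm N α R) ≤ (27 * C₁ + C₂) * Torus.eContDiffHolderNorm N α R := by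
          rw [← mul_assoc]
          refine mul_le_mul' ?_ le_rfl
          calc (C₁ : ℝ≥0∞) * 9 = 9 * C₁ := mul_comm _ _
            _ ≤ 27 * C₁ := mul_le_mul' (by norm_num) le_rfl
            _ ≤ 27 * C₁ + C₂ := le_self_add
        calc (C₁ : ℝ≥0∞) * (18 * (3 ^ N * S)) + C₁ * (9 * Torus.eContDiffHolderNorm N α R) + C₁ * (6 * (3 ^ N * S)) + C₂ * (3 ^ N * S)
            = (24 * C₁ + C₂) * (3 ^ N * S) + C₁ * (9 * Torus.eContDiffHolderNorm N α R) := by ring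
          _ ≤ (27 * C₁ + C₂) * (3 ^ N * S) + (27 * C₁ + C₂) * Torus.eContDiffHolderNorm N α R :=
              add_le_add (mul_le_mul' (add_le_add (mul_le_mul' (by norm_num) le_rfl) le_rfl) le_rfl) h9
          _ = (27 * C₁ + C₂) * (3 ^ N * S + Torus.eContDiffHolderNorm N α R) := by ring

end Forcing

end BDSV

end Literature.Analysis.FluidPDE
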